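import Summits.Ventures.PercRepro.GenQChargeT
import Summits.Ventures.PercRepro.GenQShareTables

/-!
# PercRepro — the singleton and pair shares at type `t ≤ 2` from demanding-endpoint tables (night-4, gen 3)

The type-`t` twins of `GenQShareTables.lean`, using only the demanding endpoint (`dem_t ≤ 1`): for a singleton with
`c₀ ≤ #C_x ≤ c₁` the share is at least `σ` as soon as `σ ≤ ((q + 2 − t)/(q + 2 − c) − Φ_q)/c` for every `c ∈ [c₀, c₁]`
(`single_boundT`); for a pair with `u₀ ≤ #(C_x ∪ C_y)` it is at least `τ` as soon as
`τ ≤ ((q + 2 − t)/(q + 3 − u) − Φ_q)/C(u, 2)` for every `u ∈ [u₀, q + 2]` (`pair_boundT`, through `m ≤ q + 2 − u` and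
`nb ≤ C(u, 2)`); `chargeT_ge_of_bounds_fn` sums per-element bounds.
-/

namespace PercRepro.GenQ

open Finset ThmH PerFlat SixFour ThmN

variable {α : Type*} [DecidableEq α] {M : Matroid α} [M.Finite]

/-- **The pair share at type `t ≤ 2`**: `((q + 2 − t)/(q + 3 − u) − Φ_q·dem_t)/C(u, 2) ≤ share` with
`u = #(C_x ∪ C_y)`. -/
theorem pair_shareT_ge (hs : Simple M) {G B₀ : Finset α} {q t : ℕ} (hG : G ⊆ gr M)
    (hrG : M.eRk (G : Set α) = (q : ℕ∞)) (hB : B₀ ∈ basesOf M G q) (hq : 2 ≤ q) (ht : t ≤ 2) {x y : α}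
    (hx : x ∈ G) (hxB : x ∉ B₀) (hy : y ∈ G) (hyB : y ∉ B₀) (hxy : x ≠ y) :
    (((q : ℚ) + 2 - t) / ((q : ℚ) + 3 - (fc M x B₀ ∪ fc M y B₀).card) -
        ((q : ℚ) + 2) / ((q : ℚ) + 1) * dem M G t (insert x (insert y B₀))) /
        ((fc M x B₀ ∪ fc M y B₀).card.choose 2 : ℕ) ≤
      wT M G (insert x (insert y B₀)) q t / nb M G (insert x (insert y B₀)) q := by
  set S := insert x (insert y B₀) with hSdef
  obtain ⟨hBG, hr, hc⟩ := mem_basesOf.1 hB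
  have hR : S ∈ Rq M G q := pair_mem_Rq hrG hB hx hy
  have hxS : x ∉ insert y B₀ := fun h' => by
    rcases Finset.mem_insert.1 h' with h'' | h''
    · exact hxy h''
    · exact hxB h''
  have hcardS : S.card = q + 2 := by
    rw [hSdef, Finset.card_insert_of_notMem hxS, Finset.card_insert_of_notMem hyB, hc]
  have hw0 : 0 ≤ wT M G S q t := wT_nonneg_of_card_ne hs hG hq ht hR (by rw [hcardS]; omega)
  have hnb1 := one_le_nb hR
  have hUq : (fc M x B₀ ∪ fc M y B₀).card ≤ q + 2 := by
    have : fc M x B₀ ∪ fc M y B₀ ⊆ S := Finset.union_subset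
      ((fc_subset_insert x B₀).trans (Finset.insert_subset_insert x (Finset.subset_insert y B₀)))
      ((fc_subset_insert y B₀).trans (Finset.subset_insert x _))
    have := Finset.card_le_card this
    omega
  have hm := mTr_pair_le hG hrG hB hx hxB hy hyB hxy
  have hnb := nb_pair_le_choose hG hrG hB hx hxB hy hyB hxy
  rw [← hSdef] at hm hnb
  set u := (fc M x B₀ ∪ fc M y B₀).card with hu
  have hchoose : (0 : ℚ) ≤ (u.choose 2 : ℕ) := Nat.cast_nonneg _
  have hden : (0 : ℚ) < (q : ℚ) + 3 - u := by
    have : (u : ℚ) ≤ q + 2 := by exact_mod_cast hUq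
    linarith
  have hm' : (mTr M S : ℚ) + u ≤ q + 2 := by exact_mod_cast hm
  have hqt : (0 : ℚ) ≤ (q : ℚ) + 2 - t := by
    have : (t : ℚ) ≤ 2 := by exact_mod_cast ht
    linarith
  have hwinf : (1 : ℚ) / ((q : ℚ) + 3 - u) ≤ 1 / (1 + (mTr M S : ℚ)) :=
    one_div_le_one_div_of_le (by positivity) (by linarith)
  have hwlow : ((q : ℚ) + 2 - t) / ((q : ℚ) + 3 - u) - ((q : ℚ) + 2) / ((q : ℚ) + 1) * dem M G t S ≤
      wT M G S q t := by
    unfold wT wInf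
    have := mul_le_mul_of_nonneg_left hwinf hqt
    rw [mul_one_div] at this
    linarith
  have hnb' : (nb M G S q : ℚ) ≤ (u.choose 2 : ℕ) := by exact_mod_cast hnb
  have hnbpos : (0 : ℚ) < nb M G S q := by exact_mod_cast (by omega : 0 < nb M G S q)
  calc (((q : ℚ) + 2 - t) / ((q : ℚ) + 3 - u) - ((q : ℚ) + 2) / ((q : ℚ) + 1) * dem M G t S) /
        (u.choose 2 : ℕ) ≤ wT M G S q t / (u.choose 2 : ℕ) := div_le_div_of_nonneg_right hwlow hchoose
    _ ≤ wT M G S q t / nb M G S q := div_le_div_of_nonneg_left hw0 hnbpos hnb'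

/-- **A singleton bound from a demanding-endpoint table** (`t ≤ 2`): `σ ≤ share` for `c₀ ≤ #C_x ≤ c₁`. -/
theorem single_boundT (hs : Simple M) {G B₀ : Finset α} {q t : ℕ} (hG : G ⊆ gr M)
    (hrG : M.eRk (G : Set α) = (q : ℕ∞)) (hB : B₀ ∈ basesOf M G q) (hq : 2 ≤ q) (ht : t ≤ 2) {x : α}
    (hx : x ∈ G \ B₀) {c₀ c₁ : ℕ} (hc₀ : c₀ ≤ (fc M x B₀).card) (hc₁ : (fc M x B₀).card ≤ c₁) {σ : ℚ}
    (h1 : ∀ c : ℕ, c₀ ≤ c → c ≤ c₁ →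
      σ ≤ (((q : ℚ) + 2 - t) / ((q : ℚ) + 2 - c) - ((q : ℚ) + 2) / ((q : ℚ) + 1)) / c) :
    σ ≤ wT M G (insert x B₀) q t / nb M G (insert x B₀) q := by
  have h := single_shareT_ge hs hG hrG hB hq ht (Finset.mem_sdiff.1 hx).1 (Finset.mem_sdiff.1 hx).2
  refine le_trans ?_ h
  have hd1 := dem_le_one (M := M) G (insert x B₀) t
  have hc : (0 : ℚ) < (fc M x B₀).card := by
    have := three_le_card_fc hs ((mem_basesOf.1 hB).1.trans hG) (hG (Finset.mem_sdiff.1 hx).1)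
      (indep_of_mem_basesOf hB) (mem_closure_of_mem_basesOf hG hrG hB (Finset.mem_sdiff.1 hx).1)
      (Finset.mem_sdiff.1 hx).2 (Finset.card_pos.1 (by rw [(mem_basesOf.1 hB).2.2]; omega))
    exact_mod_cast (by omega : 0 < (fc M x B₀).card)
  refine le_trans (h1 _ hc₀ hc₁) (div_le_div_of_nonneg_right ?_ hc.le)
  have hphi : (0 : ℚ) ≤ ((q : ℚ) + 2) / ((q : ℚ) + 1) := by positivity
  nlinarith [mul_le_mul_of_nonneg_left hd1 hphi]

/-- **A pair bound from a demanding-endpoint table** (`t ≤ 2`): `τ ≤ share` for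
`P ∈ (G ∖ B₀).powersetCard 2` whose two points have `u₀ ≤ #(C_x ∪ C_y)`. -/
theorem pair_boundT (hs : Simple M) {G B₀ : Finset α} {q t : ℕ} (hG : G ⊆ gr M)
    (hrG : M.eRk (G : Set α) = (q : ℕ∞)) (hB : B₀ ∈ basesOf M G q) (hq : 2 ≤ q) (ht : t ≤ 2) {P : Finset α}
    (hP : P ∈ (G \ B₀).powersetCard 2) {u₀ : ℕ}
    (hU : ∀ x ∈ P, ∀ y ∈ P, x ≠ y → u₀ ≤ (fc M x B₀ ∪ fc M y B₀).card) {τ : ℚ}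
    (h1 : ∀ u : ℕ, u₀ ≤ u → u ≤ q + 2 →
      τ ≤ (((q : ℚ) + 2 - t) / ((q : ℚ) + 3 - u) - ((q : ℚ) + 2) / ((q : ℚ) + 1)) / (u.choose 2 : ℕ)) :
    τ ≤ wT M G (B₀ ∪ P) q t / nb M G (B₀ ∪ P) q := by
  obtain ⟨x, y, hxy, hPxy, hxG, hxB, hyG, hyB, hunion⟩ := pair_decomp hP
  have hxP : x ∈ P := by rw [hPxy]; exact Finset.mem_insert_self x {y}
  have hyP : y ∈ P := by rw [hPxy]; exact Finset.mem_insert_of_mem (Finset.mem_singleton_self y)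
  have h := pair_shareT_ge hs hG hrG hB hq ht hyG hyB hxG hxB hxy.symm
  rw [hunion]
  refine le_trans ?_ h
  have hUq : (fc M y B₀ ∪ fc M x B₀).card ≤ q + 2 := by
    have : fc M y B₀ ∪ fc M x B₀ ⊆ insert y (insert x B₀) := Finset.union_subset
      ((fc_subset_insert y B₀).trans (Finset.insert_subset_insert y (Finset.subset_insert x B₀)))
      ((fc_subset_insert x B₀).trans (Finset.subset_insert y _))
    have := Finset.card_le_card this
    rw [Finset.card_insert_of_notMem (fun h' => by
        rcases Finset.mem_insert.1 h' with h'' | h''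
        · exact hxy h''.symm
        · exact hyB h''), Finset.card_insert_of_notMem hxB, (mem_basesOf.1 hB).2.2] at this
    omega
  have hd1 := dem_le_one (M := M) G (insert y (insert x B₀)) t
  have hchoose : (0 : ℚ) ≤ ((fc M y B₀ ∪ fc M x B₀).card.choose 2 : ℕ) := Nat.cast_nonneg _
  refine le_trans (h1 _ (hU y hyP x hxP hxy.symm) hUq) (div_le_div_of_nonneg_right ?_ hchoose)
  have hphi : (0 : ℚ) ≤ ((q : ℚ) + 2) / ((q : ℚ) + 1) := by positivity
  nlinarith [mul_le_mul_of_nonneg_left hd1 hphi]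

/-- **The type-`t` charge of `B₀` from per-element bounds** (`t ≤ 2`). -/
theorem chargeT_ge_of_bounds_fn (hs : Simple M) {G B₀ : Finset α} {q t : ℕ} (hG : G ⊆ gr M)
    (hrG : M.eRk (G : Set α) = (q : ℕ∞)) (hB : B₀ ∈ basesOf M G q) (hq : 2 ≤ q) (ht : t ≤ 2) (σ : α → ℚ)
    (τ : Finset α → ℚ) (hσ : ∀ x ∈ G \ B₀, σ x ≤ wT M G (insert x B₀) q t / nb M G (insert x B₀) q)
    (hτ : ∀ P ∈ (G \ B₀).powersetCard 2, τ P ≤ wT M G (B₀ ∪ P) q t / nb M G (B₀ ∪ P) q) :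
    ∑ x ∈ G \ B₀, σ x + ∑ P ∈ (G \ B₀).powersetCard 2, τ P ≤ chargeT M G q t B₀ := by
  have h := chargeT_ge_singles_add_pairs hs hG hrG hB hq ht
  have h1 := Finset.sum_le_sum hσ
  have h2 := Finset.sum_le_sum hτ
  linarith

end PercRepro.GenQ
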